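import Mathlib
import HarnessLib

/-!
# courier split of the staged transcript `OSWMechanismIsolatedGates.lean` — part 01 of 01

1-D model (gCLM/OSW), computer-assisted; not Euler/NS.  Filed under `Summits/NavierStokesRegularity/OSWSelfSimilar/` by a prover-role courier on behalf of the
mechanism seat pub-oswblow-mech (planner-pub-oswblow-mech-g31-0), cell pub-oswblow (host summit NavierStokesRegularity); the gate admits the path but
not role planner.  CONTENT = the staged transcript `pub-oswblow-mech/lean/OSWMechanismIsolatedGates.lean` (sha256 aafbe7e1fd2ebe42…,
169 lines), source lines 26–169, UNCHANGED except: (i) namespace prefix `OSWSelfSimilar.Mechanism` → `Summit.NavierStokesRegularity.OSWSelfSimilar.Mechanism`;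
(ii) [parts >= 02 only: the frames open at the cut are re-opened above the body and closed at the end; nothing to re-open here]
(iii) this docstring and, below it, the transcript's own module documentation VERBATIM (renamed).  Generated by `pub-oswblow-mech/lean/courier/make_split.py`; the parts must be filed IN ORDER
(each imports its predecessor).  First/last declarations here: `locally_three_of_accumulation` … `no_gate_sequence` (4 in this part).
AI-written transcript; kernel-checked on the farm as ONE file before splitting (see the kit's CHECKS); to be checked, not trusted.
-/

/-!
# OSWMechanismIsolatedGates — the skeleton of LEMMA 36.11(a) (MECHANISM v31e, §36.8), kernel-checked

**1-D model (gCLM/OSW), computer-assisted; not Euler/NS.**  AI-written; to be checked, not trusted.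
Cell `pub-oswblow`, mechanism seat, generation 31 (v31f companion).  Mathlib only; no `sorry`, no axiom
beyond the standard three.  Nothing here is specific to the profile equation.

LEMMA 36.11(a) says: along the global branch `𝔎`, parametrised by `σ ∈ (0, ∞)`, the set of parameters with
sink exponent `p = 3` ('gates') has no accumulation point in `(0, ∞)`.  Its proof has two ingredients:
(I) the IDENTITY THEOREM along the local real-analytic re-parametrisations of the route
    ([BT03, Thm 9.1.1(d)]): if the gates accumulate at `s > 0` then `p ≡ 3` near `s`;
(II) an OPEN–CLOSED (here: infimum) ARGUMENT on `(0, ∞)` using `p < 3` near `0⁺` (`p → 1` at the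
    De Gregorio end, THEOREM M32(a)).
Both are checked here, with the analytic input in the weakest form the argument uses:

* `locally_three_of_accumulation` — (I): if `p = (p ∘ ρ) ∘ τ` near `s` with `ρ`, `τ` mutually inverse
  between `(-1, 1)` and an open interval `(a, b) ∋ s`, `τ` continuous on `(a, b)`, `τ s = 0`, and `p ∘ ρ`
  real-analytic on `(-1, 1)`, then accumulation of `{p = 3}` at `s` forces `p = 3` on a neighbourhood of `s`
  (Mathlib's `AnalyticOnNhd.eqOn_zero_of_preconnected_of_frequently_eq_zero`).
* `gates_isolated` — (II): if (I)'s conclusion holds at every `s > 0` and `p < 3` on some `(0, σ']`, then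
  NO `s > 0` is an accumulation point of `{p = 3}`.  (Continuity of `p` is not even needed.)
-/

namespace Summit.NavierStokesRegularity.OSWSelfSimilar.Mechanism.IsolatedGates

open Set Filter Topology

/-- (I) THE IDENTITY THEOREM TRANSPORTED ALONG A LOCAL ANALYTIC RE-PARAMETRISATION.  `ρ : (-1,1) → (a,b)` and
`τ : (a,b) → (-1,1)` are mutually inverse, `τ` is continuous on `(a,b)`, `τ s = 0`, and `p ∘ ρ` is real-analytic
on `(-1,1)`.  If `p = 3` frequently on punctured neighbourhoods of `s`, then `p = 3` on a neighbourhood of `s`. -/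
theorem locally_three_of_accumulation {p ρ τ : ℝ → ℝ} {a b s : ℝ} (has : a < s) (hsb : s < b)
    (hρτ : ∀ σ ∈ Ioo a b, τ σ ∈ Ioo (-1 : ℝ) 1 ∧ ρ (τ σ) = σ)
    (hτc : ContinuousOn τ (Ioo a b)) (hτs : τ s = 0)
    (han : AnalyticOnNhd ℝ (p ∘ ρ) (Ioo (-1 : ℝ) 1))
    (hacc : ∃ᶠ σ in 𝓝[≠] s, p σ = 3) : ∀ᶠ σ in 𝓝 s, p σ = 3 := by
  have hIoo : Ioo a b ∈ 𝓝 s := Ioo_mem_nhds has hsb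
  -- τ → 0 along 𝓝[≠] s, with values ≠ 0
  have hτ_tend : Tendsto τ (𝓝[≠] s) (𝓝[≠] (0 : ℝ)) := by
    have h1 : Tendsto τ (𝓝 s) (𝓝 (τ s)) := (hτc.continuousAt hIoo).tendsto
    rw [hτs] at h1
    have h2 : Tendsto τ (𝓝[≠] s) (𝓝 (0 : ℝ)) := h1.mono_left nhdsWithin_le_nhds
    refine tendsto_nhdsWithin_iff.mpr ⟨h2, ?_⟩
    have hev1 : ∀ᶠ σ in 𝓝[≠] s, σ ∈ Ioo a b := eventually_nhdsWithin_of_eventually_nhds hIoo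
    have hev2 : ∀ᶠ σ in 𝓝[≠] s, σ ∈ ({s}ᶜ : Set ℝ) := self_mem_nhdsWithin
    filter_upwards [hev1, hev2] with σ hσ hσs
    intro hτ0
    apply hσs
    have e1 := (hρτ σ hσ).2
    have e2 := (hρτ s ⟨has, hsb⟩).2
    rw [mem_singleton_iff]
    calc σ = ρ (τ σ) := e1.symm
      _ = ρ (τ s) := by rw [hτ0, hτs]
      _ = s := e2
  -- the analytic function g := p ∘ ρ - 3 vanishes frequently near 0
  set g : ℝ → ℝ := fun t => (p ∘ ρ) t - 3 with hg
  have hgan : AnalyticOnNhd ℝ g (Ioo (-1 : ℝ) 1) := han.sub analyticOnNhd_const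
  have hgfreq : ∃ᶠ t in 𝓝[≠] (0 : ℝ), g t = 0 := by
    by_contra hnot
    have hev : ∀ᶠ t in 𝓝[≠] (0 : ℝ), g t ≠ 0 := not_frequently.mp hnot
    have hpull : ∀ᶠ σ in 𝓝[≠] s, g (τ σ) ≠ 0 := hτ_tend.eventually hev
    have hev1 : ∀ᶠ σ in 𝓝[≠] s, σ ∈ Ioo a b := eventually_nhdsWithin_of_eventually_nhds hIoo
    have hcontra : ∀ᶠ σ in 𝓝[≠] s, ¬ (p σ = 3) := by
      filter_upwards [hpull, hev1] with σ hne hσ hp3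
      apply hne
      simp only [hg, Function.comp]
      rw [(hρτ σ hσ).2, hp3]
      ring
    exact hacc hcontra
  have hzero : EqOn g 0 (Ioo (-1 : ℝ) 1) :=
    hgan.eqOn_zero_of_preconnected_of_frequently_eq_zero isPreconnected_Ioo (by norm_num) hgfreq
  -- conclude near s
  filter_upwards [hIoo] with σ hσ
  have ht := (hρτ σ hσ).1
  have h0 : g (τ σ) = 0 := hzero ht
  simp only [hg, Function.comp] at h0
  rw [(hρτ σ hσ).2] at h0
  linarith

/-- (II) THE INFIMUM ARGUMENT.  If accumulation of `{p = 3}` at any `s > 0` forces `p = 3` near `s` (the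
conclusion of (I) at every point of the route), and `p < 3` on some `(0, σ']`, then no `s > 0` is an
accumulation point of `{p = 3}`: the gates are isolated and cannot accumulate at a finite parameter. -/
theorem gates_isolated {p : ℝ → ℝ}
    (hident : ∀ s, 0 < s → (∃ᶠ σ in 𝓝[≠] s, p σ = 3) → ∀ᶠ σ in 𝓝 s, p σ = 3)
    (hsmall : ∃ σ', 0 < σ' ∧ ∀ σ, 0 < σ → σ ≤ σ' → p σ < 3) :
    ∀ s, 0 < s → ¬ (∃ᶠ σ in 𝓝[≠] s, p σ = 3) := by
  intro s hs hacc
  obtain ⟨σ', hσ'0, hσ'⟩ := hsmall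
  have hev : ∀ᶠ σ in 𝓝 s, p σ = 3 := hident s hs hacc
  have hps : p s = 3 := hev.self_of_nhds
  have hs' : σ' < s := by
    by_contra h
    push Not at h
    have := hσ' s hs h
    linarith
  -- D := parameters σ ≤ s from which p = 3 all the way up to s
  set D : Set ℝ := {σ | σ ≤ s ∧ ∀ x ∈ Icc σ s, p x = 3} with hD
  have hsD : s ∈ D := by
    refine ⟨le_rfl, fun x hx => ?_⟩
    have hxs : x = s := le_antisymm hx.2 hx.1
    rw [hxs]
    exact hps
  have hDlow : ∀ σ ∈ D, σ' < σ := by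
    intro σ hσ
    by_contra hle
    push Not at hle
    have h3 : p σ' = 3 := hσ.2 σ' ⟨hle, le_of_lt hs'⟩
    have := hσ' σ' hσ'0 le_rfl
    linarith
  have hDne : D.Nonempty := ⟨s, hsD⟩
  have hDbdd : BddBelow D := ⟨σ', fun σ hσ => le_of_lt (hDlow σ hσ)⟩
  set m := sInf D with hm
  have hmσ' : σ' ≤ m := le_csInf hDne (fun σ hσ => le_of_lt (hDlow σ hσ))
  have hm0 : 0 < m := lt_of_lt_of_le hσ'0 hmσ'
  have hms : m ≤ s := csInf_le hDbdd hsD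
  -- p = 3 on (m, s]
  have hp3 : ∀ x, m < x → x ≤ s → p x = 3 := by
    intro x hmx hxs
    obtain ⟨σ, hσD, hσx⟩ := exists_lt_of_csInf_lt hDne hmx
    exact hσD.2 x ⟨le_of_lt hσx, hxs⟩
  -- m is an accumulation point of {p = 3}
  have hmacc : ∃ᶠ σ in 𝓝[≠] m, p σ = 3 := by
    rcases eq_or_lt_of_le hms with hEq | hlt
    · rw [hEq]; exact hacc
    · have hevR : ∀ᶠ σ in 𝓝[>] m, p σ = 3 := by
        filter_upwards [Ioo_mem_nhdsGT hlt] with σ hσ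
        exact hp3 σ hσ.1 (le_of_lt hσ.2)
      have hfrR : ∃ᶠ σ in 𝓝[>] m, p σ = 3 := hevR.frequently
      exact hfrR.filter_mono (nhdsWithin_mono _ (fun x hx => ne_of_gt hx))
  -- hence p = 3 on a whole neighbourhood of m, and m - δ/2 ∈ D: contradiction with m = inf D
  have hevm : ∀ᶠ σ in 𝓝 m, p σ = 3 := hident m hm0 hmacc
  obtain ⟨δ, hδ, hball⟩ := Metric.eventually_nhds_iff.mp hevm
  have hmem : m - δ / 2 ∈ D := by
    refine ⟨by linarith, fun x hx => ?_⟩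
    by_cases hxm : x ≤ m
    · apply hball
      rw [Real.dist_eq, abs_lt]
      constructor <;> linarith [hx.1]
    · push Not at hxm
      exact hp3 x hxm hx.2
  have : m ≤ m - δ / 2 := csInf_le hDbdd hmem
  linarith

/-- LEMMA 36.11(a), SKELETON (composition of (I) and (II)).  If around every `s > 0` the parameter is locally a
homeomorphic image of `(-1, 1)` along which `p` is real-analytic (the situation produced by [BT03, Thm 9.1.1(d)]
and the boundedness of `v ↦ G_v(π)`), and `p < 3` on some `(0, σ']` (`p → 1` at the De Gregorio end), then the
level set `{p = 3}` has no accumulation point in `(0, ∞)`. -/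
theorem gates_isolated_of_local_analytic {p : ℝ → ℝ}
    (hloc : ∀ s, 0 < s → ∃ a b : ℝ, ∃ ρ τ : ℝ → ℝ, a < s ∧ s < b ∧
      (∀ σ ∈ Ioo a b, τ σ ∈ Ioo (-1 : ℝ) 1 ∧ ρ (τ σ) = σ) ∧ ContinuousOn τ (Ioo a b) ∧ τ s = 0 ∧
      AnalyticOnNhd ℝ (p ∘ ρ) (Ioo (-1 : ℝ) 1))
    (hsmall : ∃ σ', 0 < σ' ∧ ∀ σ, 0 < σ → σ ≤ σ' → p σ < 3) :
    ∀ s, 0 < s → ¬ (∃ᶠ σ in 𝓝[≠] s, p σ = 3) := by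
  apply gates_isolated _ hsmall
  intro s hs hacc
  obtain ⟨a, b, ρ, τ, has, hsb, hρτ, hτc, hτs, han⟩ := hloc s hs
  exact locally_three_of_accumulation has hsb hρτ hτc hτs han hacc

/-- The conclusion in the sequential form used in the text: no sequence of gates `σ_k ≠ s` converges to `s > 0`. -/
theorem no_gate_sequence {p : ℝ → ℝ} {s : ℝ}
    (h : ¬ (∃ᶠ σ in 𝓝[≠] s, p σ = 3)) (u : ℕ → ℝ) (hu : Tendsto u atTop (𝓝 s))
    (hne : ∀ k, u k ≠ s) (hgate : ∀ k, p (u k) = 3) : False := by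
  apply h
  have hu' : Tendsto u atTop (𝓝[≠] s) :=
    tendsto_nhdsWithin_iff.mpr ⟨hu, Eventually.of_forall (fun k => hne k)⟩
  exact (hu'.frequently (Frequently.of_forall hgate))

end Summit.NavierStokesRegularity.OSWSelfSimilar.Mechanism.IsolatedGates
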